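import Mathlib
import Summits.ValiantsHypothesis.ValiantsHypothesis.Theorems.LacunarySymmetroidMatrixDescartesDetMultiplicityJordanChain

/-!
# `MatrixDescartes` (stmt-ValiantsHypothesis-18050) — the first-order multiplicity law, CONVERSE for symmetric matrices: a
# NEUTRAL kernel vector (`vᵀM′(r)u = 0` for all kernel vectors `u`) forces `(X − r)^{corank + 1} ∣ det M`; for lacunary
# symmetric pencils a kernel vector whose Rayleigh polynomial has a DOUBLE root at `r` (corank one) forces a double root of
# `det F`

HONEST FRAMING.  Cell `pub-symmetroid`, seat `val-sym-mdr-p2` (gen 16); helper file `--supports` the crux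
`Theses.LacunarySymmetroid.MatrixDescartes`, NO closure claim.  General linear algebra (any format) completing
`…DetMultiplicityJordanChain` to an EQUIVALENCE for symmetric evaluations: `mult_r det M ≥ corank M(r) + 1` iff the kernel
form `(u, v) ↦ uᵀM′(r)v` on `ker M(r)` is degenerate.  Nothing here bears on the crux in its window, on `stub_twoSided`, on
`DoorA26`/`DoorA34`, registers, or `VP ≠ VNP`.

CONTENT.  (§1) `exists_mulVec_eq_of_forall_ker` — for a real SYMMETRIC matrix `A`, a vector orthogonal to `ker A` lies in
the range of `A` (`range A = (ker A)^⊥`: the range is inside the annihilator of the kernel, the annihilator meets the kernel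
trivially because the dot product is definite, and the dimensions add up).  (§2) `X_sub_C_pow_succ_dvd_det_of_neutral` — if
`M(r)` is symmetric and some non-zero kernel vector `v` is NEUTRAL (`vᵀM′(r)u = 0` for every kernel vector `u`), then
`w := −A⁻¹(M′(r)v)` exists and `(v, w)` is a Jordan chain of length two, so `(X − r)^{corank+1} ∣ det M`
(`Multiplicity.X_sub_C_pow_succ_dvd_det_of_chain`); with the kernel-form criterion this is an «iff».  (§3) PENCILS:
`X_sub_C_pow_succ_dvd_det_pencil_of_neutral`; for a ONE-dimensional kernel spanned by `v`, neutrality is `P_v′(r) = 0`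
(the Rayleigh polynomial `P_v = ∑ₖ (vᵀSₖv)X^{dₖ}` has a multiple root at `r`), whence `sq_dvd_det_pencil_of_double_rayleigh_root`:
`(X − r)² ∣ det F` — the tangential companion of gen 15's «two kernel vectors force a double root»
(`two_le_rootMultiplicity_det_pencil`), and `two_le_rootMultiplicity_iff_of_corank_one`: at a corank-one root,
`mult ≥ 2 ⇔ P_v′(r) = 0`. [folklore] (Gohberg–Lancaster–Rodman, Matrix Polynomials, 1982, Ch. 1: partial multiplicities
and Jordan chains); axioms standard; no definitions.
-/

-- layout Summits/ValiantsHypothesis/ValiantsHypothesis forces the duplicated namespace component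
set_option linter.dupNamespace false

namespace Summit.ValiantsHypothesis.ValiantsHypothesis.Theorems.LacunarySymmetroidMatrixDescartes

open Polynomial Matrix Finset
open scoped BigOperators

namespace Multiplicity

variable {n : Type} [Fintype n] [DecidableEq n]

/-! ## §1 Symmetric matrices: the range is the annihilator of the kernel -/

omit [DecidableEq n] in
/-- **`range A = (ker A)^⊥` for real symmetric `A`**: a vector dot-orthogonal to every kernel vector of `A` is of the form
`A w`. [folklore] -/
theorem exists_mulVec_eq_of_forall_ker (A : Matrix n n ℝ) (hA : A.IsSymm) (y : n → ℝ)
    (hy : ∀ u : n → ℝ, A *ᵥ u = 0 → u ⬝ᵥ y = 0) : ∃ w : n → ℝ, A *ᵥ w = y := by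
  classical
  let f : (n → ℝ) →ₗ[ℝ] (n → ℝ) := A.mulVecLin
  -- the annihilator of the kernel, as a submodule
  let K' : Submodule ℝ (n → ℝ) :=
    { carrier := {z | ∀ u : n → ℝ, A *ᵥ u = 0 → u ⬝ᵥ z = 0}
      add_mem' := fun {z z'} hz hz' u hu => by rw [dotProduct_add, hz u hu, hz' u hu, add_zero]
      zero_mem' := fun u _ => dotProduct_zero u
      smul_mem' := fun c z hz u hu => by
        show u ⬝ᵥ (c • z) = 0
        rw [dotProduct_smul, hz u hu, smul_zero] }
  -- the range lies in the annihilator (symmetry)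
  have hrange : LinearMap.range f ≤ K' := by
    rintro _ ⟨w, rfl⟩ u hu
    show u ⬝ᵥ (A *ᵥ w) = 0
    rw [Matrix.dotProduct_mulVec, ← Matrix.mulVec_transpose, hA.eq, hu, zero_dotProduct]
  -- the annihilator meets the kernel trivially (the dot product is definite)
  have hinf : K' ⊓ LinearMap.ker f = ⊥ := by
    rw [Submodule.eq_bot_iff]
    intro u hu
    obtain ⟨hu1, hu2⟩ := Submodule.mem_inf.1 hu
    have hker : A *ᵥ u = 0 := by
      rw [LinearMap.mem_ker] at hu2; exact hu2
    have h0 : u ⬝ᵥ u = 0 := hu1 u hker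
    exact dotProduct_self_eq_zero.1 h0
  -- dimensions
  have hdim := Submodule.finrank_sup_add_finrank_inf_eq K' (LinearMap.ker f)
  rw [hinf, finrank_bot, add_zero] at hdim
  have hsup : Module.finrank ℝ ↥(K' ⊔ LinearMap.ker f) ≤ Fintype.card n := by
    rw [← Module.finrank_fintype_fun_eq_card (R := ℝ) (η := n)]
    exact Submodule.finrank_le _
  have hrk := LinearMap.finrank_range_add_finrank_ker f
  rw [Module.finrank_fintype_fun_eq_card] at hrk
  have hle : Module.finrank ℝ K' ≤ Module.finrank ℝ (LinearMap.range f) := by omega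
  have heq : LinearMap.range f = K' := Submodule.eq_of_le_of_finrank_le hrange hle
  have hyK : y ∈ K' := hy
  rw [← heq] at hyK
  obtain ⟨w, hw⟩ := hyK
  exact ⟨w, hw⟩

/-! ## §2 A neutral kernel vector forces one more factor -/

/-- **Neutral kernel vector ⇒ Jordan chain ⇒ `(X − r)^{corank+1} ∣ det M`.**  `M(r)` symmetric, `v ≠ 0` with `M(r)v = 0`
and `vᵀ M′(r) u = 0` for every kernel vector `u` of `M(r)`.  Then `(X − r)^{corank M(r) + 1}` divides `det M`. [folklore] -/
theorem X_sub_C_pow_succ_dvd_det_of_neutral (M : Matrix n n ℝ[X]) (r : ℝ) (hsymm : (M.map (eval r)).IsSymm)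
    (v : n → ℝ) (hv0 : v ≠ 0) (hv : M.map (eval r) *ᵥ v = 0)
    (hneutral : ∀ u : n → ℝ, M.map (eval r) *ᵥ u = 0 → v ⬝ᵥ ((M.map derivative).map (eval r) *ᵥ u) = 0) :
    (X - C r) ^ (Fintype.card n - (M.map (eval r)).rank + 1) ∣ M.det := by
  set A := M.map (eval r) with hA
  set B := (M.map derivative).map (eval r) with hB
  -- the column `Bᵀ v` is orthogonal to the kernel, hence in the range of `A`
  obtain ⟨w, hw⟩ := exists_mulVec_eq_of_forall_ker A hsymm (-(v ᵥ* B)) (fun u hu => by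
    rw [dotProduct_neg, neg_eq_zero, dotProduct_comm, ← Matrix.dotProduct_mulVec]
    exact hneutral u hu)
  refine X_sub_C_pow_succ_dvd_det_of_chain M r v w hv0 ?_ ?_
  · rw [← Matrix.mulVec_transpose, hsymm.eq]; exact hv
  · show w ᵥ* A + v ᵥ* B = 0
    rw [← Matrix.mulVec_transpose, hsymm.eq, hw, neg_add_cancel]

/-- **The symmetric dichotomy.**  For symmetric `M(r)`: either every non-zero kernel vector pairs non-trivially with some
kernel vector under `M′(r)` — and then `mult_r det M = corank M(r)` — or some non-zero kernel vector is neutral — and then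
`(X − r)^{corank+1} ∣ det M`. [folklore] -/
theorem rootMultiplicity_det_eq_corank_or_dvd (M : Matrix n n ℝ[X]) (r : ℝ) (hsymm : (M.map (eval r)).IsSymm) :
    (M.det ≠ 0 ∧ M.det.rootMultiplicity r = Fintype.card n - (M.map (eval r)).rank) ∨
      (X - C r) ^ (Fintype.card n - (M.map (eval r)).rank + 1) ∣ M.det := by
  classical
  by_cases h : ∃ v : n → ℝ, v ≠ 0 ∧ M.map (eval r) *ᵥ v = 0 ∧
      ∀ u : n → ℝ, M.map (eval r) *ᵥ u = 0 → v ⬝ᵥ ((M.map derivative).map (eval r) *ᵥ u) = 0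
  · obtain ⟨v, hv0, hv, hneutral⟩ := h
    exact Or.inr (X_sub_C_pow_succ_dvd_det_of_neutral M r hsymm v hv0 hv hneutral)
  · push Not at h
    refine Or.inl (rootMultiplicity_det_eq_corank_of_no_chain M r fun v w hv hw => ?_)
    by_contra hv0
    have hvA : M.map (eval r) *ᵥ v = 0 := by rw [← hsymm.eq, Matrix.mulVec_transpose]; exact hv
    obtain ⟨u, hu, hne⟩ := h v hv0 hvA
    apply hne
    -- from the chain: `v·B = −w·A`, so `vᵀ B u = (v·B)·u = −(w·A)·u = −w·(A u) = 0`
    have h1 : v ᵥ* (M.map derivative).map (eval r) = -(w ᵥ* M.map (eval r)) := eq_neg_of_add_eq_zero_right hw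
    calc v ⬝ᵥ ((M.map derivative).map (eval r) *ᵥ u)
        = (v ᵥ* (M.map derivative).map (eval r)) ⬝ᵥ u := Matrix.dotProduct_mulVec _ _ _
      _ = -((w ᵥ* M.map (eval r)) ⬝ᵥ u) := by rw [h1, neg_dotProduct]
      _ = -(w ⬝ᵥ (M.map (eval r) *ᵥ u)) := by rw [Matrix.dotProduct_mulVec]
      _ = 0 := by rw [hu, dotProduct_zero, neg_zero]

/-! ## §3 Lacunary symmetric pencils -/

section Pencil

variable {ι κ : Type} [Fintype ι] [DecidableEq ι] [Fintype κ]

/-- **Neutral kernel vector ⇒ extra multiplicity (pencil form).**  `F(X) = ∑ₖ X^{dₖ}Sₖ` with real symmetric letters,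
`r : ℝ`, `v ≠ 0` a kernel vector of `F(r)` with `vᵀF′(r)u = 0` for every kernel vector `u` (`F′(r) = ∑ₖ dₖ r^{dₖ−1} Sₖ`).
Then `(X − r)^{dim ker F(r) + 1} ∣ det F`. [folklore] -/
theorem X_sub_C_pow_succ_dvd_det_pencil_of_neutral (d : κ → ℕ) (S : κ → Matrix ι ι ℝ) (hS : ∀ k, (S k).IsSymm)
    (r : ℝ) (v : ι → ℝ) (hv0 : v ≠ 0) (hv : (∑ k, r ^ d k • S k) *ᵥ v = 0)
    (hneutral : ∀ u : ι → ℝ, (∑ k, r ^ d k • S k) *ᵥ u = 0 →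
      v ⬝ᵥ ((∑ k, ((d k : ℝ) * r ^ (d k - 1)) • S k) *ᵥ u) = 0) :
    (X - C r) ^ (Fintype.card ι - (∑ k, r ^ d k • S k).rank + 1)
      ∣ Matrix.det (∑ k, ((X : ℝ[X]) ^ d k) • (S k).map C) := by
  have h := X_sub_C_pow_succ_dvd_det_of_neutral (∑ k, ((X : ℝ[X]) ^ d k) • (S k).map C) r
    (by rw [pencil_map_eval]; exact DefiniteMoments.isSymm_eval d S hS r) v hv0 (by rw [pencil_map_eval]; exact hv)
    (fun u hu => by
      rw [pencil_map_derivative_eval]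
      rw [pencil_map_eval] at hu
      exact hneutral u hu)
  rw [pencil_map_eval] at h
  exact h

/-- **A double Rayleigh root on a one-dimensional kernel forces a double determinant root.**  If `dim ker F(r) = 1`, `v`
spans the kernel, and the Rayleigh polynomial `P_v = ∑ₖ (vᵀSₖv)X^{dₖ}` has `P_v′(r) = 0`, then `(X − r)² ∣ det F` — the
tangential companion of «two kernel vectors force a double root». [folklore] -/
theorem sq_dvd_det_pencil_of_double_rayleigh_root (d : κ → ℕ) (S : κ → Matrix ι ι ℝ) (hS : ∀ k, (S k).IsSymm)
    (r : ℝ) (v : ι → ℝ) (hv0 : v ≠ 0) (hv : (∑ k, r ^ d k • S k) *ᵥ v = 0)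
    (hrank : (∑ k, r ^ d k • S k).rank + 1 = Fintype.card ι)
    (hker : ∀ u : ι → ℝ, (∑ k, r ^ d k • S k) *ᵥ u = 0 → ∃ c : ℝ, u = c • v)
    (hdouble : (derivative (∑ k, C (v ⬝ᵥ (S k *ᵥ v)) * (X : ℝ[X]) ^ d k)).eval r = 0) :
    (X - C r) ^ 2 ∣ Matrix.det (∑ k, ((X : ℝ[X]) ^ d k) • (S k).map C) := by
  have h := X_sub_C_pow_succ_dvd_det_pencil_of_neutral d S hS r v hv0 hv (fun u hu => by
    obtain ⟨c, rfl⟩ := hker u hu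
    rw [Matrix.mulVec_smul, dotProduct_smul, form_derivative_eq_eval, hdouble, smul_zero])
  have e : Fintype.card ι - (∑ k, r ^ d k • S k).rank + 1 = 2 := by omega
  rw [e] at h
  exact h

/-- **Corank one: `mult ≥ 2` iff the kernel vector's Rayleigh polynomial has a multiple root at `r`.** [folklore] -/
theorem two_le_rootMultiplicity_iff_of_corank_one (d : κ → ℕ) (S : κ → Matrix ι ι ℝ) (hS : ∀ k, (S k).IsSymm)
    (hdet : Matrix.det (∑ k, ((X : ℝ[X]) ^ d k) • (S k).map C) ≠ 0)
    (r : ℝ) (v : ι → ℝ) (hv0 : v ≠ 0) (hv : (∑ k, r ^ d k • S k) *ᵥ v = 0)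
    (hrank : (∑ k, r ^ d k • S k).rank + 1 = Fintype.card ι)
    (hker : ∀ u : ι → ℝ, (∑ k, r ^ d k • S k) *ᵥ u = 0 → ∃ c : ℝ, u = c • v) :
    2 ≤ (Matrix.det (∑ k, ((X : ℝ[X]) ^ d k) • (S k).map C)).rootMultiplicity r ↔
      (derivative (∑ k, C (v ⬝ᵥ (S k *ᵥ v)) * (X : ℝ[X]) ^ d k)).eval r = 0 := by
  constructor
  · intro h2
    by_contra hne
    -- every non-zero kernel vector is a multiple of `v`, hence non-neutral: multiplicity is exactly one
    have h1 := rootMultiplicity_det_pencil_eq_one d S hS r hrank (fun u hu hu0 => by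
      obtain ⟨c, rfl⟩ := hker u hu
      have hc : c ≠ 0 := fun h => hu0 (by rw [h, zero_smul])
      rw [show (∑ k, C ((c • v) ⬝ᵥ (S k *ᵥ (c • v))) * (X : ℝ[X]) ^ d k)
          = C (c ^ 2) * ∑ k, C (v ⬝ᵥ (S k *ᵥ v)) * (X : ℝ[X]) ^ d k by
        rw [Finset.mul_sum]
        refine Finset.sum_congr rfl fun k _ => ?_
        rw [Matrix.mulVec_smul, smul_dotProduct, dotProduct_smul, smul_eq_mul, smul_eq_mul, ← mul_assoc, ← sq, C_mul,
          mul_assoc]]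
      rw [derivative_C_mul, eval_mul, eval_C]
      exact mul_ne_zero (pow_ne_zero 2 hc) hne)
    omega
  · intro hdouble
    exact (le_rootMultiplicity_iff hdet).2 (sq_dvd_det_pencil_of_double_rayleigh_root d S hS r v hv0 hv hrank hker hdouble)

end Pencil

end Multiplicity

end Summit.ValiantsHypothesis.ValiantsHypothesis.Theorems.LacunarySymmetroidMatrixDescartes
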